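import Mathlib
import Summits.Ventures.PercRepro.TriangleCapThreeRowDiagonalLocus
import Summits.Ventures.PercRepro.TriangleCapTwoBelowSecondBest

/-!
# PercRepro — THE SECOND-BEST VALUE OF THE `K₄⁻`-FREE CHERRY TABLE ON EVERY CELL `(k, a, r)` WITH `r ≤ 2`
(`a ≥ 3`, `k ≥ 2a + 2`, `k ≥ r + 7` on the row `a = 3`, the single cell `(k, 4, 2)` excepted): the gap below the
closed form is `secondGap k a r` — `B2 = 2a (k − 2a − 1)` at `r = 0`; `T = 2 (k − 7)` (`a = 3`) or
`B2 = 2 (k − 2a − 1)(a − 1)` (`a ≥ 4`) at `r = 1`; `B1 = 2` at `r = 2` — and the second-best locus at `r = 2` is the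
bipartite class with two disjoint missing pairs (p3, gen 44; part 197e)

The assembly of parts 194 (the row `a = 3`), 195 (the diagonal), 196 (one and two below) and the trivial half at
`r = 2`: every non-`a`-bipartite graph is `B2 ≥ 6` below there, so a graph `2` below is `a`-bipartite with two missing
pairs that do not form a star (`two_below_second_best_locus`). Axioms: standard.
-/

namespace PercRepro

namespace TriangleCap

namespace C047

open Finset

variable {V : Type*} [Fintype V] [DecidableEq V]

/-- **THE SECOND-BEST LOCUS AT `r = 2`, EVERY ROW `a ≥ 5`:** a `K₄⁻`-free graph with `a (k − a) − 2` edges on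
`k ≥ 2a + 2` vertices with `Σ_v d(v)² + 2 (k − 3) + 2 = m k` is a spanning subgraph of some `K(A, Aᶜ)`, `|A| = a`,
whose two missing cross pairs do not form a star (two disjoint missing pairs). -/
theorem two_below_second_best_locus (D : SimpleGraph V) [DecidableRel D.Adj] (hK : K4mFree D) (a : ℕ) (ha : 5 ≤ a)
    (hk : 2 * a + 2 ≤ Fintype.card V) (hm : D.edgeFinset.card + 2 = a * (Fintype.card V - a))
    (heq : ∑ v, deg D v * deg D v + 2 * (Fintype.card V - 3) + 2 = D.edgeFinset.card * Fintype.card V) :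
    ∃ A : Finset V, A.card = a ∧ BipSub D A ∧ ¬ ∃ v, MissingStar D A v := by
  rcases two_below_second_order_gen D hK a ha hk hm with ⟨A, hAcard, hA⟩ | h
  · refine ⟨A, hAcard, hA, ?_⟩
    rintro ⟨v, hv⟩
    have h := closed_form_eq_of_missingStar D A hA hv a 2 hAcard hm (by omega)
    have e : Fintype.card V - 1 - 2 = Fintype.card V - 3 := by omega
    rw [e] at h
    omega
  · exfalso
    have hB : 6 ≤ 2 * (Fintype.card V - 2 * a - 1) * (a - 2) := by
      have h1 : 1 ≤ Fintype.card V - 2 * a - 1 := by omega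
      have h2 : 3 ≤ a - 2 := by omega
      nlinarith
    omega

/-- **THE SECOND-BEST GAP OF THE CHERRY TABLE ON THE CELLS `r ≤ 2`:** `B2 = 2a (k − 2a − 1)` at `r = 0`;
`T = 2 (k − 7)` on the row `a = 3` and `B2 = 2 (k − 2a − 1)(a − 1)` on the rows `a ≥ 4` at `r = 1`; `B1 = 2` at `r = 2`. -/
def secondGap (k a r : ℕ) : ℕ :=
  if r = 0 then 2 * a * (k - 2 * a - 1)
  else if r = 1 then (if a = 3 then 2 * (k - 7) else 2 * (k - 2 * a - 1) * (a - 1))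
  else 2

/-- **THE SECOND-BEST VALUE OF THE `K₄⁻`-FREE CHERRY TABLE ON EVERY CELL `(k, a, r)` WITH `r ≤ 2`** (`3 ≤ a`,
`2a + 2 ≤ k`, `r + 7 ≤ k` on the row `a = 3`, the cell `(k, 4, 2)` excepted): every non-extremal `K₄⁻`-free graph
on `Fin k` with `a (k − a) − r` edges has `Σ_v d(v)² + r (k − 1 − r) + secondGap k a r ≤ m k`, and the value is
attained. -/
theorem second_best_table (k a r : ℕ) (ha : 3 ≤ a) (hr : r ≤ 2) (hk : 2 * a + 2 ≤ k) (hk3 : a = 3 → r + 7 ≤ k)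
    (h42 : ¬ (a = 4 ∧ r = 2)) :
    (∀ (D : SimpleGraph (Fin k)) [DecidableRel D.Adj], K4mFree D → D.edgeFinset.card + r = a * (k - a) →
        ∑ v, deg D v * deg D v + r * (k - 1 - r) ≠ D.edgeFinset.card * k →
        ∑ v, deg D v * deg D v + r * (k - 1 - r) + secondGap k a r ≤ D.edgeFinset.card * k) ∧
      ∃ (D : SimpleGraph (Fin k)) (_ : DecidableRel D.Adj), K4mFree D ∧ D.edgeFinset.card + r = a * (k - a) ∧
        ∑ v, deg D v * deg D v + r * (k - 1 - r) + secondGap k a r = D.edgeFinset.card * k := by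
  rcases Nat.lt_or_ge r 1 with hr0 | hr1
  · -- `r = 0`: the diagonal
    obtain rfl : r = 0 := by omega
    obtain ⟨h1, D, inst, hK, hE, hS⟩ := diag_second_best_all k a ha hk
    simp only [secondGap, if_true, zero_mul, add_zero] at h1 hS ⊢
    refine ⟨fun D _ hK hm hne => h1 D hK (by omega) hne, D, inst, hK, by omega, hS⟩
  rcases Nat.lt_or_ge r 2 with hr1' | hr2
  · -- `r = 1`
    obtain rfl : r = 1 := by omega
    rcases Nat.lt_or_ge a 4 with ha3 | ha4
    · -- the row `a = 3`: the one-triangle family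
      obtain rfl : a = 3 := by omega
      obtain ⟨h1, D, inst, hK, hE, hS⟩ := three_row_second_best k 1 (le_refl 1) (hk3 rfl)
      simp only [secondGap, secondGapThree, if_true, if_false, one_ne_zero] at h1 hS ⊢
      refine ⟨fun D _ hK hm hne => h1 D hK (by omega) hne, D, inst, hK, by omega, hS⟩
    · -- the rows `a ≥ 4`: the other bipartition
      obtain ⟨h1, D, inst, hK, hE, hS⟩ := one_below_second_best_gen k a ha4 hk
      have ha3' : a ≠ 3 := by omega
      simp only [secondGap, if_true, if_false, one_ne_zero, ha3', one_mul] at h1 hS ⊢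
      have e : k - 1 - 1 = k - 2 := by omega
      rw [e]
      refine ⟨fun D _ hK hm hne => h1 D hK hm hne, D, inst, hK, hE, hS⟩
  · -- `r = 2`
    obtain rfl : r = 2 := by omega
    rcases Nat.lt_or_ge a 4 with ha3 | ha4
    · -- the row `a = 3`: the matching
      obtain rfl : a = 3 := by omega
      obtain ⟨h1, D, inst, hK, hE, hS⟩ := three_row_second_best k 2 (by norm_num) (hk3 rfl)
      simp only [secondGap, secondGapThree] at h1 hS ⊢
      refine ⟨fun D _ hK hm hne => h1 D hK (by omega) hne, D, inst, hK, by omega, hS⟩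
    · -- the rows `a ≥ 5`: the matching
      have ha5 : 5 ≤ a := by omega
      obtain ⟨h1, D, inst, hK, hE, hS⟩ := two_below_second_best_gen k a ha5 hk
      simp only [secondGap] at h1 hS ⊢
      have e : k - 1 - 2 = k - 3 := by omega
      rw [e]
      refine ⟨fun D _ hK hm hne => h1 D hK hm hne, D, inst, hK, hE, hS⟩

end C047

end TriangleCap

end PercRepro
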